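import Mathlib
import HarnessLib
import Summits.Parity.GeneralizedHardyLittlewood.Theses.LeeYangFibres
import Summits.Parity.GeneralizedHardyLittlewood.Theorems.LeeYangFibresAbsoluteUpgradeDipDefs
import Summits.Parity.GeneralizedHardyLittlewood.Theorems.LeeYangFibresFibreHyperbolicityPrimeColumn
import Summits.Parity.GeneralizedHardyLittlewood.Theorems.LeeYangFibresFibreHyperbolicityPrimeColumnHyperbolic

/-!
# `FibreHyperbolicityAlong` (stmt-Parity-18103): along the schedule, every PRIME COLUMN is hyperbolic
# (necessity theorem; negative-side support, refuter cdisprove seat, cycle 1)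

What the crux says about primes, kernel-checked.  For a coordinate `i` of a `t`-form system let
`P_m := C_{(m;1,…,1)}` (`ModelTransfer.jointCell` at `Function.update (fun _ => 1) i m`) be the PRIME COLUMN at
roughness `u`: the `n ∈ K ∩ ℤ ∩ [-N,N]` with `ψ_i(n)` `N^{1/u}`-rough, `Ω(ψ_i(n)) = m`, and `ψ_k(n)` PRIME `> N^{1/u}` for
every `k ≠ i`.

* `primeColumn_hyperbolic_of_fibres` — the POINTWISE core of the fixed-degree necessity theorem
  `ModelTransfer.primeColumn_hyperbolic_of_FHAt` (Theorems/LeeYangFibresFibreHyperbolicityPrimeColumnHyperbolic, whose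
  proof is reproduced verbatim with the crux hypothesis replaced by its only use): at ANY `(t, N, u, Ψ, K, i)`, if every
  equal-fugacity fibre `ζ ↦ fibre t N u Ψ K i (w,…,w) ζ`, `0 < w ≤ 1`, has only real zeros, then EITHER `P_m = 0` for all
  `1 ≤ m ≤ u` OR `Σ_{m=1}^{u} P_m ζ^m` has only real zeros (lower bound off the real axis for real-rooted non-negative
  polynomials against the `O(w^t)` size of the non-column layers, `w → 0⁺`).
* `primeColumn_hyperbolic_of_fibreHyperbolicityAlong` — hence `FibreHyperbolicityAlong` implies: for `N ≥ N₀(t, L, η)`,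
  every admissible `(Ψ, K)` of mass `≥ ηN` and every `i`, the prime column AT THE SCHEDULED ROUGHNESS `u = U(N)`
  (`slowDegree N`; `= 4` for all `N ≤ 2^78`) is zero or hyperbolic.  For `t = 2`, `Ψ = (n, n+2)`, `i = 0`, `N ≤ 2^78`:
  `P₂² ≥ 4 P₁ P₃` for the counts `P_m = #{n ∈ K : n + 2 prime, P⁻(n) > N^{1/4}, Ω(n) = m}` — ONE parity-sensitive
  inequality between shifted-prime almost-prime counts (HL-world value of `P₂²/(4P₁P₃)`: `2.05`; measured `2.5` at
  `N = 10⁸…10¹⁰`, strategist census §3), which is what a disproof at the physical degree would have to violate.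
[folklore]
-/

noncomputable section

namespace Summit.Parity.GeneralizedHardyLittlewood.Theorems.FibreHyperbolicityAlong.Negative

open scoped BigOperators Classical Polynomial
open Finset Polynomial
open Literature.NumberTheory.Sieve
open Summit.Parity.GeneralizedHardyLittlewood.Theses.LeeYangFibres (FibreHyperbolicityAlong)
open Summit.Parity.GeneralizedHardyLittlewood.Cruxes.FibreHyperbolicity.ModelTransfer
  (jointCell fibre fibre_const_eq frozenExp_update update_mem_box le_frozenExp_of_ne norm_sq_eval_ge_of_roots_real
    column_image_subset_box column_injOn le_frozenExp_of_not_mem_image)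
open Summit.Parity.GeneralizedHardyLittlewood.Cruxes.AbsoluteUpgrade.DipMarginRateExchange (slowDegree)

/-- **Pointwise: real-rooted equal-fugacity fibres force a hyperbolic (or zero) prime column.** [folklore] -/
theorem primeColumn_hyperbolic_of_fibres {t N u : ℕ} {Ψ : Fin t → AffLinForm 1} {K : Set (Fin 1 → ℝ)} (i : Fin t)
    (hfib : ∀ w : ℝ, 0 < w → w ≤ 1 → ∀ x : ℂ, fibre t N u Ψ K i (fun _ => w) x = 0 → x.im = 0) :
    (∀ m ∈ Finset.Icc 1 u, jointCell t N u Ψ K (Function.update (fun _ => 1) i m) = 0) ∨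
      ∀ z : ℂ, (∑ m ∈ Finset.Icc 1 u,
        ((jointCell t N u Ψ K (Function.update (fun _ => 1) i m) : ℕ) : ℂ) * z ^ m) = 0 → z.im = 0 := by
  by_cases hzero : ∀ m ∈ Finset.Icc 1 u, jointCell t N u Ψ K (Function.update (fun _ => 1) i m) = 0
  · exact Or.inl hzero
  refine Or.inr fun z hz => ?_
  by_contra him
  push Not at hzero
  obtain ⟨m₀, hm₀, hm₀ne⟩ := hzero
  have ht1 : 1 ≤ t := Nat.succ_le_of_lt (lt_of_le_of_lt (Nat.zero_le _) i.isLt)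
  -- the data
  set box := Fintype.piFinset (fun _ : Fin t => Finset.Icc 1 u) with hbox
  set e : ℕ → (Fin t → ℕ) := fun m => Function.update (fun _ : Fin t => (1 : ℕ)) i m with he
  set C : (Fin t → ℕ) → ℝ := fun j => (jointCell t N u Ψ K j : ℝ) with hCdef
  have hC0 : ∀ j, 0 ≤ C j := fun j => Nat.cast_nonneg _
  set ρ : ℝ := ‖z‖ with hρ
  have hz0 : z ≠ 0 := fun h => him (by rw [h]; simp)
  have hρpos : 0 < ρ := norm_pos_iff.mpr hz0
  -- `ρ + Re z > 0` off the real axis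
  have h1 : ρ ^ 2 = z.re ^ 2 + z.im ^ 2 := by rw [hρ, Complex.sq_norm, Complex.normSq_apply]; ring
  have hρx : 0 < ρ + z.re := by
    have him2 : 0 < z.im ^ 2 := by positivity
    by_contra hle
    push Not at hle
    nlinarith [mul_nonneg (neg_nonneg.mpr hle) (sub_nonneg.mpr (show z.re ≤ ρ from Complex.re_le_norm z))]
  -- the column weight `S = Σ_m P_m ρ^m > 0`, the size `R = Σ_m ρ^m`, the total count `B`
  set S : ℝ := ∑ m ∈ Finset.Icc 1 u, C (e m) * ρ ^ m with hS
  have hSpos : 0 < S := by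
    have hle : C (e m₀) * ρ ^ m₀ ≤ S :=
      Finset.single_le_sum (f := fun m => C (e m) * ρ ^ m)
        (fun m _ => mul_nonneg (hC0 _) (pow_nonneg hρpos.le m)) hm₀
    have hpos : 0 < C (e m₀) * ρ ^ m₀ := by
      refine mul_pos ?_ (pow_pos hρpos _)
      simp only [hCdef, he]
      exact_mod_cast Nat.pos_of_ne_zero hm₀ne
    linarith
  set R : ℝ := ∑ m ∈ Finset.Icc 1 u, ρ ^ m with hR
  have hR0 : 0 ≤ R := Finset.sum_nonneg fun m _ => pow_nonneg hρpos.le m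
  set B : ℝ := ∑ j ∈ box, C j with hB
  have hB0 : 0 ≤ B := Finset.sum_nonneg fun j _ => hC0 j
  -- the column polynomial vanishes at `z` (hypothesis), in real-coefficient form
  have hzR : (∑ m ∈ Finset.Icc 1 u, ((C (e m) : ℝ) : ℂ) * z ^ m) = 0 := by
    rw [← hz]
    refine Finset.sum_congr rfl fun m _ => ?_
    simp only [hCdef, he, Complex.ofReal_natCast]
  -- MAIN ESTIMATE at each `0 < w ≤ 1`
  have main : ∀ w : ℝ, 0 < w → w ≤ 1 →
      (ρ + z.re) ^ u * (w ^ (t - 1) * S) ^ 2 ≤ (2 * ρ) ^ u * (w ^ t * (R * B)) ^ 2 := by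
    intro w hw0 hw1
    -- the real polynomial of the equal-fugacity fibre
    set Q : ℝ[X] := ∑ j ∈ box, Polynomial.C (C j * w ^ (∑ k ∈ Finset.univ.erase i, j k)) * X ^ (j i)
      with hQdef
    have hcoeff : ∀ m, Q.coeff m =
        ∑ j ∈ box.filter (fun j => j i = m), C j * w ^ (∑ k ∈ Finset.univ.erase i, j k) := by
      intro m
      rw [hQdef, finsetSum_coeff, Finset.sum_filter]
      refine Finset.sum_congr rfl fun j _ => ?_
      rw [coeff_C_mul_X_pow]
      by_cases h : j i = m
      · rw [if_pos h.symm, if_pos h]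
      · rw [if_neg (Ne.symm h), if_neg h]
    have h0 : ∀ n, 0 ≤ Q.coeff n := fun n => by
      rw [hcoeff]
      exact Finset.sum_nonneg fun j _ => mul_nonneg (hC0 j) (pow_nonneg hw0.le _)
    have hevalC : ∀ x : ℂ, (Q.map (algebraMap ℝ ℂ)).eval x = fibre t N u Ψ K i (fun _ => w) x := by
      intro x
      rw [fibre_const_eq, hQdef, Polynomial.map_sum, eval_finsetSum]
      refine Finset.sum_congr rfl fun j _ => ?_
      rw [Polynomial.map_mul, Polynomial.map_C, Polynomial.map_pow, Polynomial.map_X, eval_mul, eval_C,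
        eval_pow, eval_X, Complex.coe_algebraMap]
    have hroots : ∀ x : ℂ, (Q.map (algebraMap ℝ ℂ)).eval x = 0 → x.im = 0 := fun x hx =>
      hfib w hw0 hw1 x ((hevalC x).symm.trans hx)
    -- real evaluation at `ρ` dominates the column layer
    have hevalR : Q.eval ρ = ∑ j ∈ box, C j * w ^ (∑ k ∈ Finset.univ.erase i, j k) * ρ ^ (j i) := by
      rw [hQdef, eval_finsetSum]
      refine Finset.sum_congr rfl fun j _ => ?_
      rw [eval_mul, eval_C, eval_pow, eval_X]
    have hlow : w ^ (t - 1) * S ≤ Q.eval ρ := by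
      rw [hevalR, hS, Finset.mul_sum]
      calc ∑ m ∈ Finset.Icc 1 u, w ^ (t - 1) * (C (e m) * ρ ^ m)
          = ∑ j ∈ (Finset.Icc 1 u).image e, C j * w ^ (∑ k ∈ Finset.univ.erase i, j k) * ρ ^ (j i) := by
            rw [Finset.sum_image (column_injOn i _)]
            refine Finset.sum_congr rfl fun m _ => ?_
            simp only [he, frozenExp_update, Function.update_self]
            ring
        _ ≤ ∑ j ∈ box, C j * w ^ (∑ k ∈ Finset.univ.erase i, j k) * ρ ^ (j i) :=
            Finset.sum_le_sum_of_subset_of_nonneg (column_image_subset_box i u) fun j _ _ =>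
              mul_nonneg (mul_nonneg (hC0 j) (pow_nonneg hw0.le _)) (pow_nonneg hρpos.le _)
    have hwt : 0 < w ^ (t - 1) := pow_pos hw0 _
    have hQne : Q ≠ 0 := by
      intro h
      have h2 := hlow
      rw [h, eval_zero] at h2
      nlinarith [mul_pos hwt hSpos]
    have hdeg : Q.natDegree ≤ u := by
      rw [hQdef]
      refine natDegree_sum_le_of_forall_le _ _ fun j hj => ?_
      calc (Polynomial.C (C j * w ^ (∑ k ∈ Finset.univ.erase i, j k)) * X ^ (j i)).natDegree ≤ j i :=
            natDegree_C_mul_X_pow_le _ _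
        _ ≤ u := (Finset.mem_Icc.mp (Fintype.mem_piFinset.mp hj i)).2
    -- lower bound for `‖Q(z)‖`
    have hLB := norm_sq_eval_ge_of_roots_real hQne h0 hroots z hdeg
    -- upper bound for `‖Q(z)‖ = ‖fibre‖`: the column layer vanishes at `z`, the rest is `O(w^t)`
    have hUB : ‖(Q.map (algebraMap ℝ ℂ)).eval z‖ ≤ w ^ t * (R * B) := by
      rw [hevalC, fibre_const_eq]
      set f : (Fin t → ℕ) → ℂ := fun j =>
        (((jointCell t N u Ψ K j : ℝ) * w ^ (∑ k ∈ Finset.univ.erase i, j k) : ℝ) : ℂ) * z ^ (j i) with hf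
      have hsplit := Finset.sum_sdiff (f := f) (column_image_subset_box i u)
      -- the column layer
      have hcol : ∑ j ∈ (Finset.Icc 1 u).image e, f j = 0 := by
        rw [Finset.sum_image (column_injOn i _)]
        have : ∀ m ∈ Finset.Icc 1 u, f (e m) = ((w ^ (t - 1) : ℝ) : ℂ) * (((C (e m) : ℝ) : ℂ) * z ^ m) := by
          intro m _
          simp only [hf, he, hCdef, frozenExp_update, Function.update_self]
          push_cast
          ring
        rw [Finset.sum_congr rfl this, ← Finset.mul_sum, hzR, mul_zero]
      change ‖∑ j ∈ box, f j‖ ≤ w ^ t * (R * B)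
      rw [← hsplit, hcol, add_zero]
      -- the rest
      calc ‖∑ j ∈ box \ (Finset.Icc 1 u).image e, f j‖
          ≤ ∑ j ∈ box \ (Finset.Icc 1 u).image e, ‖f j‖ := norm_sum_le _ _
        _ ≤ ∑ j ∈ box \ (Finset.Icc 1 u).image e, w ^ t * (R * C j) := by
            refine Finset.sum_le_sum fun j hj => ?_
            obtain ⟨hjbox, hjI⟩ := Finset.mem_sdiff.mp hj
            have hs : t ≤ ∑ k ∈ Finset.univ.erase i, j k := le_frozenExp_of_not_mem_image i hjbox hjI
            have hji : j i ∈ Finset.Icc 1 u := Fintype.mem_piFinset.mp hjbox i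
            have hρR : ρ ^ (j i) ≤ R :=
              Finset.single_le_sum (f := fun m => ρ ^ m) (fun m _ => by positivity) hji
            have ha : 0 ≤ (jointCell t N u Ψ K j : ℝ) * w ^ (∑ k ∈ Finset.univ.erase i, j k) :=
              mul_nonneg (Nat.cast_nonneg _) (pow_nonneg hw0.le _)
            have hnorm : ‖f j‖ = C j * w ^ (∑ k ∈ Finset.univ.erase i, j k) * ρ ^ (j i) := by
              simp only [hf]
              rw [norm_mul, norm_pow, Complex.norm_real, Real.norm_eq_abs, abs_of_nonneg ha]
            rw [hnorm]
            calc C j * w ^ (∑ k ∈ Finset.univ.erase i, j k) * ρ ^ (j i)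
                ≤ C j * w ^ t * R := by
                  refine mul_le_mul (mul_le_mul_of_nonneg_left (pow_le_pow_of_le_one hw0.le hw1 hs) (hC0 j))
                    hρR (by positivity) ?_
                  exact mul_nonneg (hC0 j) (pow_nonneg hw0.le _)
              _ = w ^ t * (R * C j) := by ring
        _ ≤ ∑ j ∈ box, w ^ t * (R * C j) :=
            Finset.sum_le_sum_of_subset_of_nonneg Finset.sdiff_subset fun j _ _ =>
              mul_nonneg (pow_nonneg hw0.le t) (mul_nonneg hR0 (hC0 j))
        _ = w ^ t * (R * B) := by rw [hB, Finset.mul_sum, Finset.mul_sum]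
    -- combine
    calc (ρ + z.re) ^ u * (w ^ (t - 1) * S) ^ 2
        ≤ (ρ + z.re) ^ u * (Q.eval ρ) ^ 2 :=
          mul_le_mul_of_nonneg_left (pow_le_pow_left₀ (mul_nonneg hwt.le hSpos.le) hlow 2)
            (pow_nonneg hρx.le u)
      _ ≤ (2 * ρ) ^ u * ‖(Q.map (algebraMap ℝ ℂ)).eval z‖ ^ 2 := hLB
      _ ≤ (2 * ρ) ^ u * (w ^ t * (R * B)) ^ 2 :=
          mul_le_mul_of_nonneg_left (pow_le_pow_left₀ (norm_nonneg _) hUB 2)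
            (pow_nonneg (mul_nonneg zero_le_two hρpos.le) u)
  -- divide by `w^{2(t-1)}`: `(ρ + Re z)^u S² ≤ w · M` for every `0 < w ≤ 1`
  set A : ℝ := (ρ + z.re) ^ u * S ^ 2 with hA
  set M : ℝ := (2 * ρ) ^ u * (R * B) ^ 2 with hM
  have hApos : 0 < A := mul_pos (pow_pos hρx u) (pow_pos hSpos 2)
  have hM0 : 0 ≤ M := mul_nonneg (pow_nonneg (mul_nonneg zero_le_two hρpos.le) u) (sq_nonneg _)
  have hfin : ∀ w : ℝ, 0 < w → w ≤ 1 → A ≤ w * M := by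
    intro w hw0 hw1
    have h := main w hw0 hw1
    have hwt : 0 < w ^ (t - 1) := pow_pos hw0 _
    have hwsplit : w ^ t = w ^ (t - 1) * w := by rw [← pow_succ, Nat.sub_add_cancel ht1]
    have e1 : (ρ + z.re) ^ u * (w ^ (t - 1) * S) ^ 2 = (w ^ (t - 1)) ^ 2 * A := by rw [hA]; ring
    have e2 : (2 * ρ) ^ u * (w ^ t * (R * B)) ^ 2 = (w ^ (t - 1)) ^ 2 * (w ^ 2 * M) := by
      rw [hM, hwsplit]; ring
    rw [e1, e2] at h
    have h' : A ≤ w ^ 2 * M := le_of_mul_le_mul_left h (pow_pos hwt 2)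
    calc A ≤ w ^ 2 * M := h'
      _ ≤ w * M := mul_le_mul_of_nonneg_right (by nlinarith) hM0
  -- choose `w` small
  have hpos2 : 0 < 2 * (M + 1) := by linarith
  have hw : 0 < min 1 (A / (2 * (M + 1))) := lt_min one_pos (div_pos hApos hpos2)
  have h := hfin _ hw (min_le_left _ _)
  have h3 : min 1 (A / (2 * (M + 1))) * M ≤ A / (2 * (M + 1)) * M :=
    mul_le_mul_of_nonneg_right (min_le_right _ _) hM0
  have h4 : A / (2 * (M + 1)) * M < A := by
    have hlt : M / (2 * (M + 1)) < 1 := by rw [div_lt_one hpos2]; linarith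
    calc A / (2 * (M + 1)) * M = A * (M / (2 * (M + 1))) := by ring
      _ < A * 1 := mul_lt_mul_of_pos_left hlt hApos
      _ = A := mul_one A
  linarith

/-- **`FibreHyperbolicityAlong` makes every prime column hyperbolic along the schedule.** For `N ≥ N₀(t, L, η)`, every
admissible `(Ψ, K)` of singular mass `≥ ηN` and every coordinate `i`: the prime column at roughness `U(N)` vanishes
identically or its polynomial `Σ_{m=1}^{U(N)} P_m ζ^m` has only real zeros. [folklore] -/
theorem primeColumn_hyperbolic_of_fibreHyperbolicityAlong (h : FibreHyperbolicityAlong) :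
    ∀ (t L : ℕ), 1 ≤ t → ∀ η : ℝ, 0 < η → ∃ N₀ : ℕ, ∀ N : ℕ, N₀ ≤ N →
      ∀ Ψ : Fin t → AffLinForm 1, IsNondegenerateSystem Ψ → affLinSize Ψ N ≤ L →
      ∀ K : Set (Fin 1 → ℝ), Convex ℝ K → K ⊆ realBox 1 N →
      η * (N : ℝ) ≤ archFactor Ψ K * singularProduct Ψ → ∀ i : Fin t,
        (∀ m ∈ Finset.Icc 1 (slowDegree N),
            jointCell t N (slowDegree N) Ψ K (Function.update (fun _ => 1) i m) = 0) ∨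
        ∀ z : ℂ, (∑ m ∈ Finset.Icc 1 (slowDegree N),
            ((jointCell t N (slowDegree N) Ψ K (Function.update (fun _ => 1) i m) : ℕ) : ℂ) * z ^ m) = 0 →
          z.im = 0 := by
  intro t L ht η hη
  obtain ⟨N₀, hN₀⟩ := h t L ht η hη
  refine ⟨N₀, fun N hN Ψ hΨ hsize K hK hKN hmass i => ?_⟩
  exact primeColumn_hyperbolic_of_fibres i fun w hw0 hw1 x hx =>
    hN₀ N hN Ψ hΨ hsize K hK hKN hmass i (fun _ => w) (fun _ => ⟨hw0, hw1⟩) x hx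

end Summit.Parity.GeneralizedHardyLittlewood.Theorems.FibreHyperbolicityAlong.Negative

end
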